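import Mathlib.Algebra.Group.ULift
import Mathlib.Algebra.Group.Action.Sum
import Mathlib.Data.ZMod.Defs
import Mathlib.CategoryTheory.Limits.Preserves.Shapes.Terminal
import Literature.AnabelianGeometry.SemiGraphs.QuasiTemperoidsCharts
import Literature.AnabelianGeometry.SemiGraphs.TemperoidsGaloisObjectsProofs
import Literature.AlgebraicGeometry.Frobenioids.QuasiTemperoidConnected
import HarnessLib

/-!
# Semi-graphs of anabelioids, Appendix: quasi-temperoids — Remark A.1.2 (proofs)

Mochizuki, *Semi-graphs of anabelioids*, Publ. RIMS **42** (2006), Appendix, Remark A.1.2,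
manuscript p. 80 [cite: MochizukiSemiAnbd2006, Rmk A.1.2 p.80]: "Unlike the situation with temperoids,
a quasi-temperoid does not, in general, admit a terminal object."  Proof-only companion of
`QuasiTemperoids.lean` (no definitions): the named fact `ConnectedQuasiTemperoidNoTerminal` is
DISCHARGED with the witness `Π = ℤ/2` (discrete, hence tempered), `A = Π` acting on itself
(connected): in `T[A] ⊆ B^temp(Π)` every object maps to the torsor `A`, so is a free `Π`-set; a
terminal object `T` would receive exactly one arrow from `A`, hence (arrows `Π → T` = points of `T`)
have exactly one point, on which `Π` acts trivially — but then the structure arrow `T → A` is not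
equivariant for the non-trivial element of `Π`.  The second named fact of the remark,
`ConstEmptyIsQuasiHomNotMorphism`, is DISCHARGED too: in a connected quasi-temperoid `Q ≌ T[A]`
initial objects are strict (an object mapping to an initial object is initial — transported from
`T[A] ⊆ B^temp(Π)`, where initial = empty underlying set), so the functor constant at an initial
object `E` preserves all limits of nonempty finite shape (cones into it have initial vertices) —
the empty shape being excluded by the hypothesis "no terminal object" — and all colimits; and it
sends the nondegenerate object `A` (over itself; connected) to `E`, which is degenerate since no
connected object maps to an initial one.  Nothing here takes a side on [IUTchIII] Cor. 3.12.
-/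

open CategoryTheory CategoryTheory.Limits Topology

namespace Literature.AnabelianGeometry.SemiGraphs

open Literature.AlgebraicGeometry.Frobenioids (IsConnectedObj IsNonemptyObj)
open Literature.AlgebraicGeometry.Frobenioids.QuasiTemperoid.BTempConnected (hom_ρ ρ_one_apply
  isInitial_of_isEmpty)
open Literature.AlgebraicGeometry.Frobenioids.QuasiTemperoid (IsConnectedQuasiTemperoid)

universe v₁ u u₁

/-- **Remark A.1.2, first sentence, DISCHARGED** (SemiAnbd Appendix p. 80): there is a connected
quasi-temperoid without a terminal object — `B^temp(ℤ/2)[ℤ/2]`, the free `ℤ/2`-sets.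
[cite: MochizukiSemiAnbd2006, Rmk A.1.2 p.80] -/
theorem ConnectedQuasiTemperoidNoTerminal_holds : ConnectedQuasiTemperoidNoTerminal.{u} := by
  let G : Type u := ULift.{u} (Multiplicative (ZMod 2))
  letI : TopologicalSpace G := ⊥
  haveI : DiscreteTopology G := ⟨rfl⟩
  have hG : IsTempered G := IsTempered.of_profinite
  have hbot : IsOpen ((⊥ : Subgroup G) : Set G) := isOpen_discrete _
  let A : BTemp G := BTemp.quotientObj G hG ⊥ hbot
  refine ⟨G, inferInstance, inferInstance, inferInstance, A, hG,
    GaloisObjects.isConnectedObj_quotientObj hG ⊥ hbot, fun hT => ?_⟩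
  -- the object `A` over itself, and the terminal object
  let A' : Over' A := ⟨A, ⟨𝟙 A⟩⟩
  let T : Over' A := ⊤_ (Over' A)
  -- every point `x` of `T` is the image of the base point under some arrow `A' ⟶ T`
  have hmap : ∀ x : T.obj.obj.V, ∃ f : A' ⟶ T,
      f.hom.hom.hom ((1 : G) : G ⧸ (⊥ : Subgroup G)) = x := fun x => by
    obtain ⟨f, hf⟩ := GaloisObjects.exists_hom_quotientObj hG ⊥ hbot (X := T.obj) x
      (fun k hk => by rw [Subgroup.mem_bot] at hk; subst hk; exact ρ_one_apply T.obj x)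
    exact ⟨ObjectProperty.homMk f, hf⟩
  -- hence all points of `T` coincide with the image `t` of the base point under `A' ⟶ T`
  let t : T.obj.obj.V := (terminal.from A').hom.hom.hom ((1 : G) : G ⧸ (⊥ : Subgroup G))
  have hpt : ∀ x : T.obj.obj.V, x = t := fun x => by
    obtain ⟨f, hf⟩ := hmap x
    rw [← hf, terminal.hom_ext f (terminal.from A')]
  -- the structure arrow `T → A` is equivariant; test it on the non-trivial element
  obtain ⟨p⟩ := T.property
  let g : G := ULift.up (Multiplicative.ofAdd 1)
  have hg : g ≠ 1 := by decide
  have h2 : p.hom.hom (T.obj.obj.ρ g t) = A.obj.ρ g (p.hom.hom t) := hom_ρ p g t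
  rw [hpt (T.obj.obj.ρ g t)] at h2
  obtain ⟨k, hk⟩ := QuotientGroup.mk_surjective (p.hom.hom t)
  rw [← hk, GaloisObjects.quotientObj_ρ_mk] at h2
  have h3 := (QuotientGroup.eq.mp h2)
  rw [Subgroup.mem_bot, ← mul_assoc, inv_mul_cancel_comm] at h3
  exact hg h3

/-! ### Remark A.1.2, second part: the functor constant at an empty object -/

section ConstEmpty

variable {G : Type u} [Group G] [TopologicalSpace G]

/-- In `T[A] ⊆ B^temp(Π)`: an object mapping to an object with empty underlying set has empty
underlying set. [cite: MochizukiSemiAnbd2006, Appendix p.79] -/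
theorem overPrime_isEmpty_of_hom {A : BTemp G} {X Y : Over' A} (f : X ⟶ Y)
    (h : IsEmpty Y.obj.obj.V) : IsEmpty X.obj.obj.V :=
  ⟨fun x => h.false (f.hom.hom.hom x)⟩

/-- In `T[A]`: an object with empty underlying set is initial. [cite: MochizukiSemiAnbd2006, Appendix p.79] -/
theorem overPrime_isInitial_of_isEmpty {A : BTemp G} (X : Over' A) (h : IsEmpty X.obj.obj.V) :
    Nonempty (IsInitial X) := by
  obtain ⟨hI⟩ := isInitial_of_isEmpty X.obj h
  exact ⟨IsInitial.ofUniqueHom (fun Y => ObjectProperty.homMk (hI.to Y.obj))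
    fun Y m => ObjectProperty.hom_ext _ (hI.hom_ext _ _)⟩

/-- In `T[A]`: there is an object with empty underlying set (the empty `Π`-set over `A`).
[cite: MochizukiSemiAnbd2006, Appendix p.79] -/
theorem overPrime_exists_isEmpty (A : BTemp G) : ∃ X : Over' A, IsEmpty X.obj.obj.V :=
  ⟨⟨⟨{ V := PEmpty.{u + 1}, ρ := 1 }, ⟨inferInstance, fun (z : PEmpty) => z.elim⟩⟩,
    ⟨ObjectProperty.homMk
      { hom := TypeCat.ofHom (fun z : PEmpty => z.elim)
        comm := fun _ => ConcreteCategory.hom_ext _ _ fun (z : PEmpty) => z.elim }⟩⟩,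
    inferInstanceAs (IsEmpty PEmpty)⟩

/-- In `T[A]`: an initial object has empty underlying set. [cite: MochizukiSemiAnbd2006, Appendix p.79] -/
theorem overPrime_isEmpty_of_isInitial {A : BTemp G} {E : Over' A} (hE : IsInitial E) :
    IsEmpty E.obj.obj.V := by
  obtain ⟨X, hX⟩ := overPrime_exists_isEmpty A
  exact overPrime_isEmpty_of_hom (hE.to X) hX

/-- In `T[A]`: a non-initial object has a point. [cite: MochizukiSemiAnbd2006, Appendix p.79] -/
theorem overPrime_nonempty_of_isNonemptyObj {A : BTemp G} {B : Over' A} (hB : IsNonemptyObj B) :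
    Nonempty B.obj.obj.V := by
  by_contra h
  rw [not_nonempty_iff] at h
  obtain ⟨hI⟩ := overPrime_isInitial_of_isEmpty B h
  exact hB.false hI

/-- In `T[A] ⊆ B^temp(Π)`: an object whose underlying `Π`-set is connected in `B^temp(Π)` (one
nonempty orbit) is connected in `T[A]` — a binary-cofan decomposition with nonempty legs would map it,
over `A`, to `A ⊔ A` separating two points of the single orbit.
[cite: MochizukiSemiAnbd2006, Def A.1(i) p.79] -/
theorem overPrime_isConnectedObj_of_isConnectedObj {A : BTemp G} (X : Over' A)
    (hX : IsConnectedObj X.obj) : IsConnectedObj X := by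
  classical
  obtain ⟨⟨x₀⟩, htrans⟩ := (BTemp.isConnectedObj_iff X.obj).mp hX
  obtain ⟨pX⟩ := X.property
  refine ⟨⟨fun hI => (overPrime_isEmpty_of_isInitial hI).false x₀⟩,
    fun B₁ B₂ ι₁ ι₂ hB₁ hB₂ => ⟨fun hc => ?_⟩⟩
  obtain ⟨b₁⟩ := overPrime_nonempty_of_isNonemptyObj hB₁
  obtain ⟨b₂⟩ := overPrime_nonempty_of_isNonemptyObj hB₂
  letI : MulAction G A.obj.V := Action.instMulAction A.obj
  haveI : Countable A.obj.V := A.property.1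
  -- the object `A ⊔ A` of `B^temp(Π)` and its structure map to `A`
  let AA : BTemp G := ⟨Action.ofMulAction G (A.obj.V ⊕ A.obj.V),
    inferInstanceAs (Countable (A.obj.V ⊕ A.obj.V)), fun x => by
    cases x with
    | inl a =>
      have : {g : G | (Action.ofMulAction G (A.obj.V ⊕ A.obj.V)).ρ g (Sum.inl a) = Sum.inl a} =
          {g : G | A.obj.ρ g a = a} := by
        ext g
        change g • (Sum.inl a : A.obj.V ⊕ A.obj.V) = Sum.inl a ↔ g • a = a
        rw [Sum.smul_inl, Sum.inl.injEq]
      rw [this]; exact A.property.2 a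
    | inr a =>
      have : {g : G | (Action.ofMulAction G (A.obj.V ⊕ A.obj.V)).ρ g (Sum.inr a) = Sum.inr a} =
          {g : G | A.obj.ρ g a = a} := by
        ext g
        change g • (Sum.inr a : A.obj.V ⊕ A.obj.V) = Sum.inr a ↔ g • a = a
        rw [Sum.smul_inr, Sum.inr.injEq]
      rw [this]; exact A.property.2 a⟩
  let inlA : A ⟶ AA := ObjectProperty.homMk
    { hom := TypeCat.ofHom (fun a : A.obj.V => (Sum.inl a : A.obj.V ⊕ A.obj.V))
      comm := fun g => ConcreteCategory.hom_ext _ _ fun a => (Sum.smul_inl (a := g) (b := a)).symm }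
  let inrA : A ⟶ AA := ObjectProperty.homMk
    { hom := TypeCat.ofHom (fun a : A.obj.V => (Sum.inr a : A.obj.V ⊕ A.obj.V))
      comm := fun g => ConcreteCategory.hom_ext _ _ fun a => (Sum.smul_inr (a := g) (c := a)).symm }
  let codiag : AA ⟶ A := ObjectProperty.homMk
    { hom := TypeCat.ofHom (Sum.elim id id : A.obj.V ⊕ A.obj.V → A.obj.V)
      comm := fun g => ConcreteCategory.hom_ext _ _ fun x => by
        cases x with
        | inl a => rfl
        | inr a => rfl }
  let AA' : Over' A := ⟨AA, ⟨codiag⟩⟩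
  let k₁ : B₁ ⟶ AA' := ObjectProperty.homMk (ι₁.hom ≫ pX ≫ inlA)
  let k₂ : B₂ ⟶ AA' := ObjectProperty.homMk (ι₂.hom ≫ pX ≫ inrA)
  let u : X ⟶ AA' := hc.desc (BinaryCofan.mk k₁ k₂)
  have hu₁ : ι₁ ≫ u = k₁ := hc.fac (BinaryCofan.mk k₁ k₂) ⟨WalkingPair.left⟩
  have hu₂ : ι₂ ≫ u = k₂ := hc.fac (BinaryCofan.mk k₁ k₂) ⟨WalkingPair.right⟩
  -- the two points of `X` and the element of `Π` moving one to the other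
  let x₁ : X.obj.obj.V := ι₁.hom.hom.hom b₁
  let x₂ : X.obj.obj.V := ι₂.hom.hom.hom b₂
  have hx₁ : u.hom.hom.hom x₁ = Sum.inl (pX.hom.hom x₁) := by
    have := congrArg (fun φ : B₁ ⟶ AA' => φ.hom.hom.hom b₁) hu₁
    exact this
  have hx₂ : u.hom.hom.hom x₂ = Sum.inr (pX.hom.hom x₂) := by
    have := congrArg (fun φ : B₂ ⟶ AA' => φ.hom.hom.hom b₂) hu₂
    exact this
  obtain ⟨g, hg⟩ := htrans x₁ x₂
  have h := hom_ρ u.hom g x₁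
  rw [hg, hx₂, hx₁] at h
  change (Sum.inr (pX.hom.hom x₂) : A.obj.V ⊕ A.obj.V) =
    g • (Sum.inl (pX.hom.hom x₁) : A.obj.V ⊕ A.obj.V) at h
  rw [Sum.smul_inl] at h
  exact Sum.inr_ne_inl h

/-- In particular, for `A` connected, the object `A` over itself is connected in `T[A]`.
[cite: MochizukiSemiAnbd2006, Def A.1(i) p.79] -/
theorem overPrime_isConnectedObj_self {A : BTemp G} (hA : IsConnectedObj A) :
    IsConnectedObj (⟨A, ⟨𝟙 A⟩⟩ : Over' A) :=
  overPrime_isConnectedObj_of_isConnectedObj _ hA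

end ConstEmpty

/-- **Initial objects of a connected quasi-temperoid are strict**: an object admitting an arrow to an
initial object is initial (transported from `T[A] ⊆ B^temp(Π)`, where initial = empty underlying
set); declared into the predicate's namespace for dot-notation.
[cite: MochizukiSemiAnbd2006, Def A.1(i) p.79] -/
theorem _root_.Literature.AlgebraicGeometry.Frobenioids.QuasiTemperoid.IsConnectedQuasiTemperoid.nonempty_isInitial_of_hom
    {Q : Type u₁} [Category.{v₁} Q]
    (hQ : IsConnectedQuasiTemperoid.{v₁, u₁, u} Q) {E W : Q} (hE : IsInitial E) (f : W ⟶ E) :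
    Nonempty (IsInitial W) := by
  obtain ⟨c⟩ := isConnectedQuasiTemperoid_iff_nonempty_chart.mp hQ
  have hE' : IsInitial (c.equiv.functor.obj E) := hE.isInitialObj c.equiv.functor E
  have h1 : IsEmpty (c.equiv.functor.obj W).obj.obj.V :=
    overPrime_isEmpty_of_hom (c.equiv.functor.map f) (overPrime_isEmpty_of_isInitial hE')
  obtain ⟨hW⟩ := overPrime_isInitial_of_isEmpty _ h1
  exact ⟨(hW.isInitialObj c.equiv.inverse _).ofIso (c.equiv.unitIso.app W).symm⟩

/-- A connected quasi-temperoid has a connected, nondegenerate object (the image of `A` over itself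
under a chart `Q ≌ B^temp(Π)[A]`). [cite: MochizukiSemiAnbd2006, Def A.1(ii) p.79] -/
theorem _root_.Literature.AlgebraicGeometry.Frobenioids.QuasiTemperoid.IsConnectedQuasiTemperoid.exists_isConnectedObj_isNondegenerateObj
    {Q : Type u₁} [Category.{v₁} Q] (hQ : IsConnectedQuasiTemperoid.{v₁, u₁, u} Q) :
    ∃ N : Q, IsConnectedObj N ∧ IsNondegenerateObj N := by
  obtain ⟨c⟩ := isConnectedQuasiTemperoid_iff_nonempty_chart.mp hQ
  let A' : Over' c.A := ⟨c.A, ⟨𝟙 _⟩⟩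
  refine ⟨c.equiv.inverse.obj A',
    TemperoidTransport.isConnectedObj_functor_obj c.equiv.symm
      (overPrime_isConnectedObj_self c.isConnectedObj), fun B hB => ?_⟩
  obtain ⟨f⟩ := (c.equiv.functor.obj B).property
  exact ⟨B, hB, ⟨𝟙 B⟩, ⟨c.equiv.unitIso.hom.app B ≫
    c.equiv.inverse.map (ObjectProperty.homMk f : c.equiv.functor.obj B ⟶ A')⟩⟩

/-- **Remark A.1.2, second part, DISCHARGED** (SemiAnbd Appendix p. 80): in a connected
quasi-temperoid without terminal object, the functor constant at an empty [initial] object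
preserves finite limits and countable colimits but not nondegenerate objects.
[cite: MochizukiSemiAnbd2006, Rmk A.1.2 p.80] -/
theorem ConstEmptyIsQuasiHomNotMorphism_holds : ConstEmptyIsQuasiHomNotMorphism.{v₁, u, u₁} := by
  intro Q _ hQ hT E hE
  have strict : ∀ {W : Q} (_ : W ⟶ E), Nonempty (IsInitial W) := fun f =>
    hQ.nonempty_isInitial_of_hom hE f
  refine ⟨⟨fun J _ _ => ⟨fun {K} => ⟨fun {cn} hc => ?_⟩⟩⟩,
    fun J _ _ => ⟨fun {K} => ⟨fun {cn} hc => ?_⟩⟩, fun hall => ?_⟩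
  · -- finite limits: the empty shape would give a terminal object; otherwise cones into `E`
    -- have initial vertices
    by_cases hJ : IsEmpty J
    · refine absurd (IsTerminal.hasTerminal (IsTerminal.ofUniqueHom
        (fun Y => hc.lift
          { pt := Y, π := { app := fun j => isEmptyElim j, naturality := fun j => isEmptyElim j } })
        (fun Y m => hc.uniq
          { pt := Y, π := { app := fun j => isEmptyElim j, naturality := fun j => isEmptyElim j } }
          m (fun j => isEmptyElim j)))) hT
    · obtain ⟨j₀⟩ := not_isEmpty_iff.mp hJ
      refine ⟨{ lift := fun s => s.π.app j₀, fac := fun s j => ?_, uniq := fun s m _ => ?_ }⟩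
      · obtain ⟨hs⟩ := strict (s.π.app j₀)
        exact hs.hom_ext _ _
      · obtain ⟨hs⟩ := strict (s.π.app j₀)
        exact hs.hom_ext _ _
  · -- all colimits: the image cocone has the initial vertex `E`
    exact ⟨{ desc := fun s => hE.to s.pt
             fac := fun s j => hE.hom_ext _ _
             uniq := fun s m _ => hE.hom_ext _ _ }⟩
  · -- nondegenerate objects are not preserved: a connected nondegenerate `N` exists, while no
    -- connected object maps to `E`
    obtain ⟨N, hNc, hN⟩ := hQ.exists_isConnectedObj_isNondegenerateObj
    obtain ⟨C, hC, -, ⟨k⟩⟩ := hall N hN N hNc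
    obtain ⟨hCI⟩ := strict k
    exact hC.1.false hCI

end Literature.AnabelianGeometry.SemiGraphs
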